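import Mathlib
import Literature.AlgebraicGeometry.Resolution.CobordantBlowupGlobal
import Literature.AlgebraicGeometry.Resolution.Blowups
import Literature.AlgebraicGeometry.Resolution.BlowupPrincipalCharts
import Summits.ResolutionOfSingularities.ResolutionOfSingularities.Theorems.WeightedInvariantDefs
import Summits.ResolutionOfSingularities.ResolutionOfSingularities.Theorems.WeightedInvariantDatumToEmbeddedAtlasDefs
import Summits.ResolutionOfSingularities.ResolutionOfSingularities.Theorems.WeightedInvariantDatumToEmbeddedAtlasLemmas
import Summits.ResolutionOfSingularities.ResolutionOfSingularities.Theorems.WeightedInvariantDatumToEmbeddedAtlasBridge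
import HarnessLib

/-!
# The graded atlas on the cobordant blow-up: one chart, and the cover (crux `DatumToEmbedded`, line `Sketch`)

Support file for the lead's stub `stub_qs_atlas` of the line `Sketch` of the crux
`Theses.WeightedInvariant.DatumToEmbedded` (stmt-ResolutionOfSingularities-0572): the assembly of
the graded atlas of rank `j + 1` (`GradedAtlas`, `Theorems/WeightedInvariantDefs.lean`) on the
strict transform `X' ⊆ B₊ = R'.plus` over the blow-up `V' = Bl_K V` of the quotient
(Włodarczyk, arXiv:2203.03090, §2.3.3), continued from `…AtlasBridge.lean`.

For ONE chart — an ambient chart `𝒞 : AmbientChart j f i q 𝒜 J R' Dg a β` over the old chart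
`W a` (unit `η = β t^{Dg}`, `t⁻¹`, degree-`(0,0)` sections `x t^{Dg l}/η^l`) and an open
`U' ⊆ ρ⁻¹(U a)` downstairs with `i'⁻¹ W' = q'⁻¹ U'` whose sections are the `ρ♯c / ρ♯b^l`,
`c ∈ K(U a)^l` (the principal chart of the blow-up at `b`, `i♯ β = q♯ b`):

* `exists_lift_chart` — every section of `V'` over `U'` is `q'♯ c' = i'♯ s` for a degree-`0`
  section `s` of the chart (`exists_lift_pow` + `𝒞.exists_mem_zero` + the cancellation);
* `exists_preimage_chart` — every degree-`0` section `s` descends: `i'♯ s = q'♯ c'`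
  (`𝒞.exists_of_mem_zero` + `exists_preimage_pow` (Veronese generation (A2)) + the cancellation);
* `isHomogeneous_ker_chart` — the ideal of `X'` on the chart is homogeneous;
* `snoc_smul_eq`, `exists_unit_chart` — homogeneous units of every degree in `(e Dg)·ℤʲ⁺¹`:
  `π₊♯ u · η^{e m}` for an old unit `u` of degree `e Dg χ` and `m` the last coordinate;
* `exists_finset_span_eq`, `exists_mem_blowupChart` — finitely many generators of `K(U a)` on the
  locally Noetherian `V`, and the principal charts at them cover `ρ⁻¹(U a)`
  (`IsBlowup.iSup_blowupChart`).

All proofs are glue on Mathlib and the tree; no definitions, no named facts.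
-/

noncomputable section

open CategoryTheory AlgebraicGeometry TopologicalSpace
open Literature.AlgebraicGeometry.Resolution
open scoped nonZeroDivisors

set_option linter.dupNamespace false -- mandated namespace `…Theorems.DatumToEmbedded.<Topic>`
-- `Γ(B₊, W')` versus `presheaf.obj` inside `rw` motives and instance problems on the glued scheme
-- `R'.cobordantBlowup` / `R'.plus` (as in `…DatumToEmbedded.AtlasAmbientChart`):
set_option backward.isDefEq.respectTransparency false

namespace Summit.ResolutionOfSingularities.ResolutionOfSingularities.Theorems.DatumToEmbedded.Atlas

/-! ## Sections of `V'` over one chart: lifting and descending -/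

section Sections

variable {k : Type} [Field k] {Y X V X' V' : Scheme.{0}} {f : Y ⟶ Spec (.of k)} {i : X ⟶ Y}
  [IsClosedImmersion i] {q : X ⟶ V} [QuasiCompact q] {j : ℕ} (𝒜 : GradedAtlas j f i q)
  (J : ℕ → Y.IdealSheafData) {R' : ReesFiltration Y} (Dg : ℕ) [IsIntegral X']
  {i' : X' ⟶ R'.plus} {σX : X' ⟶ X} (hσX : σX ≫ i = i' ≫ R'.πPlus)
  (hτ : (((i' ≫ R'.plus.ι ≫ R'.toA1) ⁻¹ᵁ
    PrimeSpectrum.basicOpen (Polynomial.X : Polynomial ReesFiltration.ZZ.{0}) : X'.Opens) :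
      Set X').Nonempty)
  {ρ : V' ⟶ V} {q' : X' ⟶ V'} (hq' : q' ≫ ρ = σX ≫ q)
  (a : 𝒜.ι) {b : Γ(V, 𝒜.U a)} {β : Γ(Y, 𝒜.W a)}
  (hβ : i.app (𝒜.W a) β = q.appLE (𝒜.U a) (i ⁻¹ᵁ (𝒜.W a)) (𝒜.preimage_eq a).le b)
  (𝒞 : AmbientChart j f i q 𝒜 J R' Dg a β)
  {U' : V'.Opens} (hU' : U' ≤ ρ ⁻¹ᵁ (𝒜.U a : V.Opens))
  (hQ1 : i' ⁻¹ᵁ (𝒞.W' : (R'.plus : Scheme.{0}).Opens) = q' ⁻¹ᵁ U')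

include hσX hτ hq' hβ in
/-- **Every section of `V'` over the chart lifts to a degree-`0` section** of the ambient chart:
`c' = ρ♯c/ρ♯b^l` with `c ∈ K(U a)^l`, `q♯ c = i♯ x` with `x ∈ J_{Dg l}(W a)` of degree `0`
(`exists_lift_pow`), `x t^{Dg l}/η^l = s` of degree `(0,0)` (`𝒞.exists_mem_zero`), and
`q'♯ c' = i'♯ s` by the cancellation. [cite: Wlodarczyk2022, §2.3.3] -/
theorem exists_lift_chart (hJ0 : J 0 = ⊤) (hJmul : ∀ m n : ℕ, J m * J n ≤ J (m + n))
    (hJhom : letI := 𝒜.gradedRing a; ((J Dg).ideal (𝒜.W a)).IsHomogeneous (𝒜.piece a))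
    (hQ3 : ∀ c' : Γ(V', U'), ∃ (l : ℕ) (c : Γ(V, 𝒜.U a)),
      c ∈ ((((J Dg).comap i).subschemeι ≫ q).ker).ideal (𝒜.U a) ^ l ∧
      c' * ρ.appLE (𝒜.U a) U' hU' b ^ l = ρ.appLE (𝒜.U a) U' hU' c)
    (c' : Γ(V', U')) :
    ∃ s ∈ 𝒞.piece 0,
      q'.appLE U' (i' ⁻¹ᵁ (𝒞.W' : (R'.plus : Scheme.{0}).Opens)) hQ1.le c' = i'.app 𝒞.W' s := by
  obtain ⟨l, c, hc, hc'⟩ := hQ3 c'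
  obtain ⟨x, hxJ, hx0, hx⟩ := exists_lift_pow 𝒜 J Dg a hJ0 hJmul hJhom l hc
  obtain ⟨s, hs0, hs⟩ := 𝒞.exists_mem_zero l x hxJ hx0
  exact ⟨s, hs0, appLE_eq_app_of_mul_pow_eq hσX hτ hq' hβ 𝒞 hU' hQ1 hc' hx hs⟩

include hσX hτ hq' hβ in
/-- **Every degree-`0` section of the ambient chart descends to `V'`**: `s η^l (t⁻¹)^{Dg l} = π₊♯ x`
with `x ∈ J_{Dg l}(W a)` of degree `0` (`𝒞.exists_of_mem_zero`), `i♯ x = q♯ c` with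
`c ∈ K(U a)^l` (`exists_preimage_pow`, Veronese generation (A2)), `ρ♯ c = c' ρ♯b^l` on the
principal chart, and `q'♯ c' = i'♯ s` by the cancellation. [cite: Wlodarczyk2022, §2.3.3] -/
theorem exists_preimage_chart
    (hA2 : ∀ (l : ℕ) (x : Γ(Y, 𝒜.W a)), x ∈ (J (Dg * (l + 1))).ideal (𝒜.W a) →
      x ∈ 𝒜.piece a 0 → ∃ y ∈ AddSubgroup.closure
        {z : Γ(Y, 𝒜.W a) | ∃ u v : Γ(Y, 𝒜.W a),
          u ∈ (J Dg).ideal (𝒜.W a) ∧ u ∈ 𝒜.piece a 0 ∧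
          v ∈ (J (Dg * l)).ideal (𝒜.W a) ∧ v ∈ 𝒜.piece a 0 ∧ z = u * v},
        x - y ∈ i.ker.ideal (𝒜.W a))
    (hQ3' : ∀ (l : ℕ) (c : Γ(V, 𝒜.U a)),
      c ∈ ((((J Dg).comap i).subschemeι ≫ q).ker).ideal (𝒜.U a) ^ l →
      ∃ c' : Γ(V', U'), c' * ρ.appLE (𝒜.U a) U' hU' b ^ l = ρ.appLE (𝒜.U a) U' hU' c)
    (s : Γ((R'.plus : Scheme.{0}), 𝒞.W')) (hs0 : s ∈ 𝒞.piece 0) :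
    ∃ c' : Γ(V', U'),
      q'.appLE U' (i' ⁻¹ᵁ (𝒞.W' : (R'.plus : Scheme.{0}).Opens)) hQ1.le c' = i'.app 𝒞.W' s := by
  obtain ⟨l, x, hxJ, hx0, hs⟩ := 𝒞.exists_of_mem_zero s hs0
  obtain ⟨c, hc, hcx⟩ := exists_preimage_pow 𝒜 J Dg a hA2 l hxJ hx0
  obtain ⟨c', hc'⟩ := hQ3' l c hc
  exact ⟨c', appLE_eq_app_of_mul_pow_eq hσX hτ hq' hβ 𝒞 hU' hQ1 hc' hcx.symm hs⟩

end Sections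

/-! ## One chart: homogeneity of the ideal of `X'`, homogeneous units -/

section Units

variable {k : Type} [Field k] {Y X V X' : Scheme.{0}} {f : Y ⟶ Spec (.of k)} {i : X ⟶ Y}
  [IsClosedImmersion i] {q : X ⟶ V} {j : ℕ} {𝒜 : GradedAtlas j f i q}
  {J : ℕ → Y.IdealSheafData} {R' : ReesFiltration Y} {Dg : ℕ}
  {i' : X' ⟶ R'.plus} {σX : X' ⟶ X} (hσX : σX ≫ i = i' ≫ R'.πPlus)
  {a : 𝒜.ι} {β : Γ(Y, 𝒜.W a)}

/-- **The ideal of the strict transform `X' = V(I')` on the chart is homogeneous** (`ker ι' = I'`,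
`𝒞.isHomogeneous`). [folklore] -/
theorem isHomogeneous_ker_chart (𝒞 : AmbientChart j f i q 𝒜 J R' Dg a β) :
    letI := 𝒞.gradedRing
    (((R'.strictTransformPlus i.ker).subschemeι.ker).ideal 𝒞.W').IsHomogeneous 𝒞.piece := by
  rw [Scheme.IdealSheafData.ker_subschemeι]
  exact 𝒞.isHomogeneous

/-- The degree arithmetic of the new units: for `χ' = (χ, m) ∈ ℤʲ × ℤ`,
`(e Dg χ, 0) + (e m)·(0, Dg) = (e Dg)·χ'`. [folklore] -/
theorem snoc_smul_eq (e Dg : ℕ) (χ' : Fin (j + 1) → ℤ) :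
    (Fin.snoc (α := fun _ => ℤ) (e • (Dg • fun k : Fin j => χ' k.castSucc)) 0 : Fin (j + 1) → ℤ) +
        ((e : ℤ) * χ' (Fin.last j)) • (Fin.snoc (α := fun _ => ℤ) 0 (Dg : ℤ) : Fin (j + 1) → ℤ) =
      (e * Dg) • χ' := by
  funext k
  refine Fin.lastCases ?_ (fun k₀ => ?_) k
  · simp only [Pi.add_apply, Pi.smul_apply, Fin.snoc_last]
    simp only [smul_eq_mul, nsmul_eq_mul, zero_add]
    push_cast
    ring
  · simp only [Pi.add_apply, Pi.smul_apply, Fin.snoc_castSucc, Pi.zero_apply]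
    simp only [smul_eq_mul, nsmul_eq_mul, mul_zero, add_zero]
    push_cast
    ring

include hσX in
/-- **Homogeneous units of every degree in `(e Dg)·ℤʲ⁺¹` on the new chart**: for
`χ' = (χ, m)`, the section `π₊♯ u · η^{e m}` with `u` an old homogeneous unit of degree
`e·(Dg χ)` on `X ∩ W a` (its pull-back to `X' ∩ W'` is a unit) and `η = β t^{Dg}` the unit of the
chart (degree `(0, Dg)`; integer powers of a homogeneous unit are homogeneous).
[cite: Wlodarczyk2022, §2.3.3] -/
theorem exists_unit_chart (𝒞 : AmbientChart j f i q 𝒜 J R' Dg a β) (e : ℕ)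
    (hunits : ∀ χ : Fin j → ℤ, ∃ s ∈ 𝒜.piece a (e • χ), IsUnit (i.app (𝒜.W a) s))
    (χ' : Fin (j + 1) → ℤ) :
    ∃ s ∈ 𝒞.piece ((e * Dg) • χ'), IsUnit (i'.app 𝒞.W' s) := by
  letI := 𝒞.gradedRing
  obtain ⟨u, hu, huunit⟩ := hunits (Dg • fun k : Fin j => χ' k.castSucc)
  have hπu := 𝒞.appLE_mem _ u hu
  have hη : ((𝒞.isUnit_η.unit ^ ((e : ℤ) * χ' (Fin.last j)) :
      (Γ((R'.plus : Scheme.{0}), 𝒞.W'))ˣ) : Γ((R'.plus : Scheme.{0}), 𝒞.W')) ∈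
        𝒞.piece (((e : ℤ) * χ' (Fin.last j)) • (Fin.snoc (α := fun _ => ℤ) 0 (Dg : ℤ))) :=
    zpow_unit_mem 𝒞.piece (u := 𝒞.isUnit_η.unit) 𝒞.η_mem _
  refine ⟨R'.πPlus.appLE (𝒜.W a) 𝒞.W' 𝒞.le_preimage u *
    ((𝒞.isUnit_η.unit ^ ((e : ℤ) * χ' (Fin.last j)) : (Γ((R'.plus : Scheme.{0}), 𝒞.W'))ˣ) :
      Γ((R'.plus : Scheme.{0}), 𝒞.W')), ?_, ?_⟩
  · rw [← snoc_smul_eq e Dg χ']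
    exact SetLike.mul_mem_graded hπu hη
  · rw [map_mul]
    exact (isUnit_app_appLE hσX 𝒞.le_preimage huunit).mul ((Units.isUnit _).map _)

end Units

/-! ## The cover downstairs -/

section Cover

variable {V V' : Scheme.{0}} {ρ : V' ⟶ V} {K : V.IdealSheafData}

/-- On a locally Noetherian scheme, the sections of an ideal sheaf over an affine open are
finitely generated. [folklore] -/
theorem exists_finset_span_eq [IsLocallyNoetherian V] (K : V.IdealSheafData) (U : V.affineOpens) :
    ∃ s : Finset Γ(V, U), Ideal.span (s : Set Γ(V, U)) = K.ideal U := by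
  haveI := IsLocallyNoetherian.component_noetherian U
  exact IsNoetherian.noetherian (K.ideal U)

/-- **The principal charts at generators of `K(U)` cover `ρ⁻¹(U)`** (`IsBlowup.iSup_blowupChart`):
every point over `U` lies in the chart of some generator. [cite: StacksProject, Tag 0804] -/
theorem exists_mem_blowupChart (hρ : IsBlowup ρ K) (U : V.affineOpens) (s : Finset Γ(V, U))
    (hs : Ideal.span (s : Set Γ(V, U)) = K.ideal U) {v : V'} (hv : ρ v ∈ (U : V.Opens)) :
    ∃ b : s, v ∈ blowupChart ρ K U (b : Γ(V, U)) := by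
  have hcov := hρ.iSup_blowupChart (U := U) (fun b : s => (b : Γ(V, U)))
    (by rw [Subtype.range_coe_subtype, Finset.setOf_mem, hs])
  have hv' : v ∈ ρ ⁻¹ᵁ (U : V.Opens) := hv
  rw [← hcov, Opens.mem_iSup] at hv'
  exact hv'

end Cover

/-! ## Registered form -/

/-- **Registered sub-goal `stub_qs_atlasCharts`** of the lead's `stub_qs_atlas` (this helper file):
every section of `V'` over one chart of the new atlas lifts to a degree-`0` section of the
ambient chart (`exists_lift_chart`). [cite: Wlodarczyk2022, §2.3.3] -/
theorem stub_qs_atlasCharts :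
    ∀ {k : Type} [Field k] {Y X V X' V' : Scheme.{0}} {f : Y ⟶ Spec (.of k)} {i : X ⟶ Y}
      [IsClosedImmersion i] {q : X ⟶ V} [QuasiCompact q] {j : ℕ} (𝒜 : GradedAtlas j f i q)
      (J : ℕ → Y.IdealSheafData) {R' : ReesFiltration Y} (Dg : ℕ) [IsIntegral X']
      {i' : X' ⟶ R'.plus} {σX : X' ⟶ X}, σX ≫ i = i' ≫ R'.πPlus →
      (((i' ≫ R'.plus.ι ≫ R'.toA1) ⁻¹ᵁ
        PrimeSpectrum.basicOpen (Polynomial.X : Polynomial ReesFiltration.ZZ.{0}) : X'.Opens) :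
          Set X').Nonempty →
      ∀ {ρ : V' ⟶ V} {q' : X' ⟶ V'}, q' ≫ ρ = σX ≫ q →
      ∀ (a : 𝒜.ι) {b : Γ(V, 𝒜.U a)} {β : Γ(Y, 𝒜.W a)},
        i.app (𝒜.W a) β = q.appLE (𝒜.U a) (i ⁻¹ᵁ (𝒜.W a)) (𝒜.preimage_eq a).le b →
      ∀ (𝒞 : AmbientChart j f i q 𝒜 J R' Dg a β) {U' : V'.Opens}
        (hU' : U' ≤ ρ ⁻¹ᵁ (𝒜.U a : V.Opens))
        (hQ1 : i' ⁻¹ᵁ (𝒞.W' : (R'.plus : Scheme.{0}).Opens) = q' ⁻¹ᵁ U'),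
        J 0 = ⊤ → (∀ m n : ℕ, J m * J n ≤ J (m + n)) →
        @Ideal.IsHomogeneous (Fin j → ℤ) (AddSubgroup Γ(Y, 𝒜.W a)) Γ(Y, 𝒜.W a) _ _ _ (𝒜.piece a)
          _ _ (𝒜.gradedRing a) ((J Dg).ideal (𝒜.W a)) →
        (∀ c' : Γ(V', U'), ∃ (l : ℕ) (c : Γ(V, 𝒜.U a)),
          c ∈ ((((J Dg).comap i).subschemeι ≫ q).ker).ideal (𝒜.U a) ^ l ∧
          c' * ρ.appLE (𝒜.U a) U' hU' b ^ l = ρ.appLE (𝒜.U a) U' hU' c) →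
        ∀ c' : Γ(V', U'), ∃ s ∈ 𝒞.piece 0,
          q'.appLE U' (i' ⁻¹ᵁ (𝒞.W' : (R'.plus : Scheme.{0}).Opens)) hQ1.le c' = i'.app 𝒞.W' s := by
  intro _ _ _ _ _ _ _ _ _ _ _ _ _ 𝒜 J _ Dg _ _ _ hσX hτ _ _ hq' a _ _ hβ 𝒞 _ hU' hQ1 hJ0 hJmul hJhom hQ3 c'
  exact exists_lift_chart 𝒜 J Dg hσX hτ hq' a hβ 𝒞 hU' hQ1 hJ0 hJmul hJhom hQ3 c'

end Summit.ResolutionOfSingularities.ResolutionOfSingularities.Theorems.DatumToEmbedded.Atlas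

end
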